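/-
Copyright (c) 2026 the pub-hodgecm-mathlib formalisation cell (harness21).  Prover seat hodgecm-mathlib-F0P3a-p02 (g17): road «S3-ram» (junction pen F0P3a-p01 (g17),
J-PACK v2 (f) isoceles wave, socket S5 «POOLED OFF-REGION LINE COUNTS»; lattice halves F0P3-p03 (g15)), the residual census in the VERTEX FRAME `J̄₀`; 2026-09-02.
-/
import Literature.NumberTheory.Rogawski1990.DepthZeroKappaTransferTypeOneRamifiedAxisAdaptedCensus   -- ★ p847624 (this seat): adapted census `2αβ + νγ²`, `Q = c(νγ)² + λβ²`
import Literature.LinearAlgebra.QuadraticFormCountCongruence                                       -- ★ p847552 (this seat): `k × k × k ≃ Fin 3 → k`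
import HarnessLib

/-!
# The residual census at an axis vertex IN ITS OWN FRAME: isotropic vectors of `2x₀x₂ + x₁²` (the Gram `J̄₀ = antidiag(1,1,1)`) cut by the class of
# `Q = c·(x₁ + t·x₂)² + l·x₂²` — the shear `t` is invisible (Rogawski 1990 §4.9; Kottwitz 1986 §3)

Topic `NumberTheory/Rogawski1990`; namespace `Literature.NumberTheory.Rogawski1990`.  THEOREMS ONLY (no definition, no instance, no notation, no named fact, no `sorry`); kernel
lane `--supports stmt-HodgeConjecture-24833`.  Cell `pub/hodgecm-mathlib` (D-0151), crux H413; road «S3-ram» (count-neutral); junction J-PACK v2 (F0P3a-p01 (g17)) iso socket S5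
(hand F0P3a-p02 (g17), statement-first `F0/P3a/F0P3a-p02/g17/iso/JunctionSocketsS45.statementfirst.v2…lean`), per-vertex LINE CENSUS: in the unitary frame `u₀` of a
region vertex adapted to its INWARD isotropic line `e₀` (Gram `J̄₀`: `⟨x̄,x̄⟩ = 2x̄₀x̄₂ + x̄₁²`), the residual leading matrix `Ȳ` has isotropic values
`Q_Ȳ(x̄) = c·(x̄₁ + t x̄₂)² + l·x̄₂²` (`ū = ē₁ + tē₀` the isolated line up to the frame's shear, `l = 0` at ROOT∕INTERIOR vertices, `l ≠ 0` at END vertices — the shape row of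
F0P3-p03 (g15)).  THIS FILE: the shear `(x₀, x₁, x₂) ↦ (x₀ − t x₁ − (t²∕2) x₂, x₁ + t x₂, x₂)` is a bijection of `k³` preserving `2x₀x₂ + x₁²`, so every count is the `t = 0`
count of ★ `DepthZeroKappaTransferTypeOneRamifiedAxisAdaptedCensus` (with `ν = 1`, coordinates `(α, β, γ) = (x₀, x₂, x₁)`):
  **`#{x ≠ 0 : 2x₀x₂ + x₁² = 0 ∧ P(c(x₁ + tx₂)² + l x₂²)} = (q−1)·([P 0] + #{s : P(l + c s²)})`** (§1, both `k × k × k` and `Fin 3 → k` currencies),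
hence (§2) ROOT∕INTERIOR (`l = 0`, `c ≠ 0`): `2(q−1)` null vectors, the rest in the ONE class of `c`; END (`l, c ≠ 0`): `(q−1)(2 + χ(−lc))` null vectors and
`2·#{χ(c₀Q) = σ} = (q−1)(q − 1 − χ(−lc) − σχ(c₀c))` — ★ p847624 §2–§3 verbatim after the shear.
HONEST LABEL: HC_CM is proved only modulo the 2 remaining named inputs (hLiu418 24832, h413 24833) until rung 0 closes; finite-field algebra only, nothing printed is asserted.
-/

set_option autoImplicit false

namespace Literature.NumberTheory.Rogawski1990

open Finset
open Literature.LinearAlgebra.QuadraticFormCountCongruence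

variable {k : Type*} [Field k] [Fintype k] [DecidableEq k]

/-! ## §1 The shear is invisible -/

/-- **THE SHEAR.**  `#{(α,β,γ) ≠ 0 : 2αβ + γ² = 0 ∧ P(c(γ + tβ)² + lβ²)} = #{(α,β,γ) ≠ 0 : 2αβ + γ² = 0 ∧ P(cγ² + lβ²)}` for any `P` (`char k ≠ 2`): the map
`(α, β, γ) ↦ (α − tγ − (t²∕2)β, β, γ + tβ)` is a bijection of `k³` preserving the form `2αβ + γ²` and carrying `γ + tβ ↦ γ`. [cite: Kottwitz1986, §3] [cite: IrelandRosen1990, Ch. 8 §1] -/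
theorem card_iso_shear_eq (hk : ringChar k ≠ 2) (c t l : k) (P : k → Prop) [DecidablePred P] :
    (univ.filter fun v : k × k × k => v ≠ 0 ∧ 2 * v.1 * v.2.1 + v.2.2 ^ 2 = 0 ∧ P (c * (v.2.2 + t * v.2.1) ^ 2 + l * v.2.1 ^ 2)).card =
      (univ.filter fun v : k × k × k => v ≠ 0 ∧ 2 * v.1 * v.2.1 + v.2.2 ^ 2 = 0 ∧ P (c * v.2.2 ^ 2 + l * v.2.1 ^ 2)).card := by
  have h2 : (2 : k) ≠ 0 := Ring.two_ne_zero hk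
  -- the shear and its inverse
  refine Finset.card_bij (fun v _ => (v.1 - t * v.2.2 - t ^ 2 / 2 * v.2.1, v.2.1, v.2.2 + t * v.2.1)) (fun v hv => ?_) (fun v₁ _ v₂ _ h => ?_) (fun w hw => ?_)
  · rw [Finset.mem_filter] at hv ⊢
    obtain ⟨-, hv0, hiso, hP⟩ := hv
    refine ⟨Finset.mem_univ _, fun h0 => hv0 ?_, ?_, hP⟩
    · obtain ⟨ha, hb, hg⟩ := Prod.ext_iff.1 h0 |>.imp id (fun h2 => Prod.ext_iff.1 h2)
      dsimp only at ha hb hg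
      simp only [Prod.fst_zero, Prod.snd_zero] at ha hb hg
      rw [hb, mul_zero, add_zero] at hg
      rw [hb, hg, mul_zero, mul_zero, sub_zero, sub_zero] at ha
      ext <;> simp [ha, hb, hg]
    · have : 2 * (v.1 - t * v.2.2 - t ^ 2 / 2 * v.2.1) * v.2.1 + (v.2.2 + t * v.2.1) ^ 2 = 2 * v.1 * v.2.1 + v.2.2 ^ 2 := by field_simp; ring
      rw [this]; exact hiso
  · obtain ⟨ha, hb, hg⟩ := Prod.ext_iff.1 h |>.imp id (fun h2 => Prod.ext_iff.1 h2)
    dsimp only at ha hb hg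
    have hg' : v₁.2.2 = v₂.2.2 := by rw [hb] at hg; exact add_right_cancel hg
    have ha' : v₁.1 = v₂.1 := by rw [hb, hg'] at ha; linear_combination ha
    exact Prod.ext ha' (Prod.ext hb hg')
  · rw [Finset.mem_filter] at hw
    obtain ⟨-, hw0, hiso, hP⟩ := hw
    refine ⟨(w.1 + t * (w.2.2 - t * w.2.1) + t ^ 2 / 2 * w.2.1, w.2.1, w.2.2 - t * w.2.1), ?_, ?_⟩
    · rw [Finset.mem_filter]
      refine ⟨Finset.mem_univ _, fun h0 => hw0 ?_, ?_, ?_⟩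
      · obtain ⟨ha, hb, hg⟩ := Prod.ext_iff.1 h0 |>.imp id (fun h2 => Prod.ext_iff.1 h2)
        dsimp only at ha hb hg
        simp only [Prod.fst_zero, Prod.snd_zero] at ha hb hg
        rw [hb, mul_zero, sub_zero] at hg
        rw [hb, hg] at ha
        have ha' : w.1 = 0 := by linear_combination ha
        ext <;> simp [ha', hb, hg]
      · have : 2 * (w.1 + t * (w.2.2 - t * w.2.1) + t ^ 2 / 2 * w.2.1) * w.2.1 + (w.2.2 - t * w.2.1) ^ 2 = 2 * w.1 * w.2.1 + w.2.2 ^ 2 := by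
          field_simp; ring
        rw [this]; exact hiso
      · have : w.2.2 - t * w.2.1 + t * w.2.1 = w.2.2 := by ring
        rw [this]; exact hP
    · ext <;> dsimp only <;> ring

/-- **THE VERTEX-FRAME CENSUS (`k × k × k`)**: `#{(α,β,γ) ≠ 0 : 2αβ + γ² = 0 ∧ P(c(γ + tβ)² + lβ²)} = (q−1)·([P 0] + #{s : P(l + c·s²)})` for `char k ≠ 2` and `P`
invariant under non-zero squares (★ `card_iso_adapted_pred_eq` at `ν = 1` after the shear). [cite: Rogawski1990, §4.9 Prop. 4.9.1 (b) p. 55] [cite: Kottwitz1986, §3] -/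
theorem card_iso_vertexFrame_pred_eq (hk : ringChar k ≠ 2) (c t l : k) (P : k → Prop) [DecidablePred P] (hP : ∀ s z : k, z ≠ 0 → (P (z ^ 2 * s) ↔ P s)) :
    (univ.filter fun v : k × k × k => v ≠ 0 ∧ 2 * v.1 * v.2.1 + v.2.2 ^ 2 = 0 ∧ P (c * (v.2.2 + t * v.2.1) ^ 2 + l * v.2.1 ^ 2)).card =
      (Fintype.card k - 1) * ((if P 0 then 1 else 0) + (univ.filter fun s : k => P (l + c * s ^ 2)).card) := by
  rw [card_iso_shear_eq hk c t l P]
  have h := card_iso_adapted_pred_eq hk (one_ne_zero) c l P hP (ν := (1 : k))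
  simp only [one_mul, one_pow, mul_one] at h
  exact h

/-- **THE VERTEX-FRAME CENSUS (`Fin 3 → k`, the frame's own coordinates `x = (x₀, x₁, x₂)`, Gram `2x₀x₂ + x₁²`, `Q = c(x₁ + t x₂)² + l x₂²)**.
[cite: Rogawski1990, §4.9 Prop. 4.9.1 (b) p. 55] [cite: Kottwitz1986, §3] -/
theorem card_iso_vertexFrame_pred_eq_fin (hk : ringChar k ≠ 2) (c t l : k) (P : k → Prop) [DecidablePred P] (hP : ∀ s z : k, z ≠ 0 → (P (z ^ 2 * s) ↔ P s)) :
    (univ.filter fun x : Fin 3 → k => x ≠ 0 ∧ 2 * x 0 * x 2 + x 1 ^ 2 = 0 ∧ P (c * (x 1 + t * x 2) ^ 2 + l * x 2 ^ 2)).card =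
      (Fintype.card k - 1) * ((if P 0 then 1 else 0) + (univ.filter fun s : k => P (l + c * s ^ 2)).card) := by
  rw [← card_iso_vertexFrame_pred_eq hk c t l P hP]
  symm
  refine Finset.card_bij (fun v _ => (![v.1, v.2.2, v.2.1] : Fin 3 → k)) (fun v hv => ?_) (fun v₁ _ v₂ _ h => ?_) (fun w hw => ?_)
  · rw [Finset.mem_filter] at hv ⊢
    obtain ⟨-, hv0, hiso, hPv⟩ := hv
    refine ⟨Finset.mem_univ _, fun h0 => hv0 ?_, by simpa using hiso, by simpa using hPv⟩
    have h1 := congrFun h0 0; have h2 := congrFun h0 1; have h3 := congrFun h0 2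
    simp only [Matrix.cons_val_zero, Matrix.cons_val_one, Matrix.cons_val_two, Matrix.head_cons, Matrix.tail_cons, Pi.zero_apply] at h1 h2 h3
    ext <;> simp [h1, h2, h3]
  · have h1 := congrFun h 0; have h2 := congrFun h 1; have h3 := congrFun h 2
    simp only [Matrix.cons_val_zero, Matrix.cons_val_one, Matrix.cons_val_two, Matrix.head_cons, Matrix.tail_cons] at h1 h2 h3
    exact Prod.ext h1 (Prod.ext h3 h2)
  · rw [Finset.mem_filter] at hw
    obtain ⟨-, hw0, hiso, hPw⟩ := hw
    refine ⟨(w 0, w 2, w 1), ?_, ?_⟩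
    · rw [Finset.mem_filter]
      refine ⟨Finset.mem_univ _, fun h0 => hw0 ?_, by simpa using hiso, by simpa using hPw⟩
      obtain ⟨ha, hb, hd⟩ := Prod.ext_iff.1 h0 |>.imp id (fun h2 => Prod.ext_iff.1 h2)
      dsimp only at ha hb hd
      simp only [Prod.fst_zero, Prod.snd_zero] at ha hb hd
      funext i
      fin_cases i <;> simp [ha, hb, hd]
    · funext i
      fin_cases i <;> rfl

/-! ## §2 ROOT∕INTERIOR and END, in the vertex frame -/

/-- ROOT∕INTERIOR (`l = 0`, `c ≠ 0`): `2(q−1)` null isotropic vectors (the two axial lines). [cite: Rogawski1990, §4.9 Prop. 4.9.1 (b) p. 55] -/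
theorem card_iso_vertexFrame_interior_null (hk : ringChar k ≠ 2) {c : k} (hc : c ≠ 0) (t : k) :
    (univ.filter fun x : Fin 3 → k => x ≠ 0 ∧ 2 * x 0 * x 2 + x 1 ^ 2 = 0 ∧ c * (x 1 + t * x 2) ^ 2 + 0 * x 2 ^ 2 = 0).card = (Fintype.card k - 1) * 2 := by
  rw [card_iso_vertexFrame_pred_eq_fin hk c t 0 (fun s => s = 0) (fun s z hz => by simp [hz])]
  have h1 : (univ.filter fun s : k => (0 + c * s ^ 2 = 0)).card = 1 := by
    rw [Finset.card_eq_one]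
    exact ⟨0, by ext s; simp [hc]⟩
  rw [h1]
  simp

/-- ROOT∕INTERIOR, CLASS count: `(q−1)²·[χ(c₀c) = σ]`. [cite: Rogawski1990, §4.9 Prop. 4.9.1 (b) p. 55] [cite: IrelandRosen1990, Ch. 8 §1] -/
theorem card_iso_vertexFrame_interior_class (hk : ringChar k ≠ 2) {c c₀ : k} (t : k) {σ : ℤ} (hσ : σ = 1 ∨ σ = -1) :
    (univ.filter fun x : Fin 3 → k => x ≠ 0 ∧ 2 * x 0 * x 2 + x 1 ^ 2 = 0 ∧ quadraticChar k (c₀ * (c * (x 1 + t * x 2) ^ 2 + 0 * x 2 ^ 2)) = σ).card =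
      (Fintype.card k - 1) * ((Fintype.card k - 1) * (if quadraticChar k (c₀ * c) = σ then 1 else 0)) := by
  have hP : ∀ s z : k, z ≠ 0 → (quadraticChar k (c₀ * (z ^ 2 * s)) = σ ↔ quadraticChar k (c₀ * s) = σ) := fun s z hz => by
    rw [show c₀ * (z ^ 2 * s) = c₀ * s * z ^ 2 by ring, map_mul, map_pow, quadraticChar_sq_one hz, mul_one]
  rw [card_iso_vertexFrame_pred_eq_fin hk c t 0 (fun s => quadraticChar k (c₀ * s) = σ) hP]
  have h1 := card_filter_pred_mul_sq_eq (one_ne_zero) (fun s => quadraticChar k (c₀ * s) = σ) hP (ν := (1 : k)) (c := c)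
  simp only [one_pow, mul_one] at h1
  have h0 : ¬ (quadraticChar k (c₀ * 0) = σ) := by
    rw [mul_zero, MulChar.map_zero]; rcases hσ with rfl | rfl <;> decide
  rw [h1, if_neg h0, zero_add, zero_add]

/-- END (`l, c ≠ 0`): `(q−1)(2 + χ(−lc))` null isotropic vectors — the inward line plus `1 + χ(−lc)` E-lines. [cite: Rogawski1990, §4.9 Prop. 4.9.1 (b) p. 55] -/
theorem card_iso_vertexFrame_end_null (hk : ringChar k ≠ 2) {c l : k} (hc : c ≠ 0) (hl : l ≠ 0) (t : k) :
    ((univ.filter fun x : Fin 3 → k => x ≠ 0 ∧ 2 * x 0 * x 2 + x 1 ^ 2 = 0 ∧ c * (x 1 + t * x 2) ^ 2 + l * x 2 ^ 2 = 0).card : ℤ) =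
      ((Fintype.card k : ℤ) - 1) * (2 + quadraticChar k (-(l * c))) := by
  rw [card_iso_vertexFrame_pred_eq_fin hk c t l (fun s => s = 0) (fun s z hz => by simp [hz])]
  have h := card_iso_adapted_end_null hk (one_ne_zero) hc hl (ν := (1 : k))
  rw [card_iso_adapted_pred_eq hk one_ne_zero c l (fun s => s = 0) (fun s z hz => by simp [hz])] at h
  simpa only [one_pow, mul_one, one_mul] using h

/-- END, CLASS count: `2·#{χ(c₀Q) = σ} = (q−1)(q − 1 − χ(−lc) − σχ(c₀c))` (BIG `((q−3)∕2, (q−1)∕2)`, SMALL `((q−1)∕2, (q+1)∕2)` per line).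
[cite: Rogawski1990, §4.9 Prop. 4.9.1 (b) p. 55] [cite: IrelandRosen1990, Ch. 8 §2] -/
theorem two_mul_card_iso_vertexFrame_end_class (hk : ringChar k ≠ 2) {c l c₀ : k} (hc : c ≠ 0) (hl : l ≠ 0) (hc₀ : c₀ ≠ 0) (t : k) {σ : ℤ} (hσ : σ = 1 ∨ σ = -1) :
    2 * ((univ.filter fun x : Fin 3 → k => x ≠ 0 ∧ 2 * x 0 * x 2 + x 1 ^ 2 = 0 ∧ quadraticChar k (c₀ * (c * (x 1 + t * x 2) ^ 2 + l * x 2 ^ 2)) = σ).card : ℤ) =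
      ((Fintype.card k : ℤ) - 1) * ((Fintype.card k : ℤ) - 1 - quadraticChar k (-(l * c)) - σ * quadraticChar k (c₀ * c)) := by
  have hP : ∀ s z : k, z ≠ 0 → (quadraticChar k (c₀ * (z ^ 2 * s)) = σ ↔ quadraticChar k (c₀ * s) = σ) := fun s z hz => by
    rw [show c₀ * (z ^ 2 * s) = c₀ * s * z ^ 2 by ring, map_mul, map_pow, quadraticChar_sq_one hz, mul_one]
  rw [card_iso_vertexFrame_pred_eq_fin hk c t l (fun s => quadraticChar k (c₀ * s) = σ) hP]
  have h := two_mul_card_iso_adapted_end_class hk (one_ne_zero) hc hl hc₀ hσ (ν := (1 : k))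
  rw [card_iso_adapted_pred_eq hk one_ne_zero c l (fun s => quadraticChar k (c₀ * s) = σ) hP] at h
  simpa only [one_pow, mul_one, one_mul] using h

end Literature.NumberTheory.Rogawski1990
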